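import Summits.KontsevichZagierPeriods.KontsevichZagierPeriods.Theorems.UnfoldedStokesStokesGenerationStubRungPartition
import Mathlib.Topology.UniformSpace.HeineCantor
import Mathlib.Analysis.SpecialFunctions.Trigonometric.ArctanDeriv
import Mathlib.Analysis.SpecificLimits.Basic

/-!
# `StokesGeneration` (stmt-KontsevichZagierPeriods-3586) — line `fibrewise_stokes`, stub `stub_saPartition`

Registered stub X4 (rung 10) of the line `fibrewise_stokes` of the crux `StokesGeneration`
(route UnfoldedStokes): **the grid partition of a continuous zero-free loop**.

Let `A`, `B : ℝ → ℝ` be continuous on `[0,1]` with `A² + B² ≠ 0` there, and let `M ≥ 0`. Then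
there is a mesh `N ≥ 1` such that on every piece `[k/N, (k+1)/N]` (`k < N`) the re-centred real
part `A(u) A(k/N) + B(u) B(k/N)` is positive, and moreover `M/N < π/2` and
`M · tan² (M/N) < π/2`.

This is the continuous analogue of the rung-4 stub `stub_rungPartition` (same statement for real
polynomials, file `UnfoldedStokesStokesGenerationStubRungPartition`), whose grid bookkeeping
`rungPartition_grid_mem` and the two `A, B`-independent smallness facts
`rungPartition_eventually_div_lt`, `rungPartition_eventually_tan_lt` are reused verbatim.

Proof. `F(u,v) = A(u) A(v) + B(u) B(v)` is continuous on the compact square `[0,1]²`, hence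
uniformly continuous (Heine–Cantor), and `F(v,v) = A(v)² + B(v)² ≥ m > 0` where `m` is the
minimum of `A² + B²` on `[0,1]` (extreme value theorem). With `δ` the uniform-continuity modulus
for `ε = m`, every `N` with `1/N < δ` works: for `u ∈ [k/N, (k+1)/N]`, `k < N`, both `u` and
`v = k/N` lie in `[0,1]` and `|u − v| ≤ 1/N < δ`, so `F(u,v) > F(v,v) − m ≥ 0`. The two smallness
conditions hold for all large `N`. All four conditions hold eventually along `atTop`, so a common
`N` exists. [folklore]

References: M. Kontsevich, D. Zagier, *Periods* (2001), §1.2 (context only; the statement is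
elementary real analysis).
-/

noncomputable section

-- `Summit.KontsevichZagierPeriods.KontsevichZagierPeriods.…` is the tree's mandated layout (single-conjunct summit).
set_option linter.dupNamespace false

namespace Summit.KontsevichZagierPeriods.KontsevichZagierPeriods.Cruxes.StokesGeneration.FibrewiseStokes

open Set

/-! ## Positivity of the re-centred real part on a fine grid (continuous version) -/

/-- If `A`, `B` are continuous on `[0,1]` and `A² + B² ≠ 0` there, then for all sufficiently
large `N`, on every grid piece `[k/N, (k+1)/N]` (`k < N`) one has
`A(u) A(k/N) + B(u) B(k/N) > 0` (uniform continuity of `(u,v) ↦ A(u) A(v) + B(u) B(v)` on the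
compact square `[0,1]²` and the positive minimum of `A² + B²` on `[0,1]`). [folklore] -/
theorem saPartition_eventually_pos (A B : ℝ → ℝ)
    (hA : ContinuousOn A (Set.Icc (0:ℝ) 1)) (hB : ContinuousOn B (Set.Icc (0:ℝ) 1))
    (hAB : ∀ u ∈ Set.Icc (0:ℝ) 1, A u ^ 2 + B u ^ 2 ≠ 0) :
    ∀ᶠ N : ℕ in Filter.atTop, ∀ k : ℕ, k < N →
      ∀ u ∈ Set.Icc ((k : ℝ) / N) (((k : ℝ) + 1) / N),
        0 < A u * A ((k : ℝ) / N) + B u * B ((k : ℝ) / N) := by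
  -- the positive minimum `m` of `A² + B²` on `[0,1]`
  have hEc : ContinuousOn (fun u : ℝ => A u ^ 2 + B u ^ 2) (Set.Icc (0:ℝ) 1) :=
    (hA.pow 2).add (hB.pow 2)
  obtain ⟨x₀, hx₀, hmin⟩ :=
    isCompact_Icc.exists_isMinOn (Set.nonempty_Icc.2 (zero_le_one' ℝ)) hEc
  set m : ℝ := A x₀ ^ 2 + B x₀ ^ 2 with hm_def
  have hm : 0 < m := lt_of_le_of_ne (by positivity) (hAB x₀ hx₀).symm
  -- uniform continuity of `F (u, v) = A u * A v + B u * B v` on the compact square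
  have hK : IsCompact (Set.Icc (0:ℝ) 1 ×ˢ Set.Icc (0:ℝ) 1) := isCompact_Icc.prod isCompact_Icc
  have hA1 : ContinuousOn (fun p : ℝ × ℝ => A p.1) (Set.Icc (0:ℝ) 1 ×ˢ Set.Icc (0:ℝ) 1) :=
    hA.comp continuous_fst.continuousOn fun p hp => hp.1
  have hA2 : ContinuousOn (fun p : ℝ × ℝ => A p.2) (Set.Icc (0:ℝ) 1 ×ˢ Set.Icc (0:ℝ) 1) :=
    hA.comp continuous_snd.continuousOn fun p hp => hp.2
  have hB1 : ContinuousOn (fun p : ℝ × ℝ => B p.1) (Set.Icc (0:ℝ) 1 ×ˢ Set.Icc (0:ℝ) 1) :=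
    hB.comp continuous_fst.continuousOn fun p hp => hp.1
  have hB2 : ContinuousOn (fun p : ℝ × ℝ => B p.2) (Set.Icc (0:ℝ) 1 ×ˢ Set.Icc (0:ℝ) 1) :=
    hB.comp continuous_snd.continuousOn fun p hp => hp.2
  have hFc : ContinuousOn (fun p : ℝ × ℝ => A p.1 * A p.2 + B p.1 * B p.2)
      (Set.Icc (0:ℝ) 1 ×ˢ Set.Icc (0:ℝ) 1) :=
    (hA1.mul hA2).add (hB1.mul hB2)
  have hUC := hK.uniformContinuousOn_of_continuous hFc
  rw [Metric.uniformContinuousOn_iff] at hUC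
  obtain ⟨δ, hδ, hδF⟩ := hUC m hm
  have hev : ∀ᶠ N : ℕ in Filter.atTop, (1:ℝ) / N < δ :=
    (tendsto_const_div_atTop_nhds_zero_nat (1:ℝ)).eventually_lt_const hδ
  filter_upwards [hev, Filter.eventually_ge_atTop 1] with N hNδ hN1
  intro k hk u hu
  obtain ⟨hu01, hv01, hdist⟩ := rungPartition_grid_mem hN1 hk hu
  set v : ℝ := (k : ℝ) / N with hv_def
  have hmem1 : (u, v) ∈ Set.Icc (0:ℝ) 1 ×ˢ Set.Icc (0:ℝ) 1 := ⟨hu01, hv01⟩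
  have hmem2 : (v, v) ∈ Set.Icc (0:ℝ) 1 ×ˢ Set.Icc (0:ℝ) 1 := ⟨hv01, hv01⟩
  have hd : dist (u, v) (v, v) < δ := by
    rw [Prod.dist_eq, dist_self, max_eq_left dist_nonneg]
    exact lt_of_le_of_lt hdist hNδ
  have key := hδF (u, v) hmem1 (v, v) hmem2 hd
  rw [Real.dist_eq] at key
  have hlow := (abs_lt.1 key).1
  have hminv : m ≤ A v ^ 2 + B v ^ 2 := (isMinOn_iff.1 hmin) v hv01
  have hsq : A v ^ 2 + B v ^ 2 = A v * A v + B v * B v := by ring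
  simp only at hlow
  linarith

/-! ## The registered stub -/

/-- **Registered stub `stub_saPartition` (X4, rung 10 of the line `fibrewise_stokes`).**
For `A`, `B : ℝ → ℝ` continuous on `[0,1]` with `A² + B² ≠ 0` there and `M ≥ 0` there is a mesh
`N ≥ 1` such that `A(u) A(k/N) + B(u) B(k/N) > 0` for `u ∈ [k/N, (k+1)/N]`, `k < N` (the loop
`P = A + iB` re-centred at the grid point stays in the right half-plane on each piece), and
`M/N < π/2`, `M · tan² (M/N) < π/2`. Heine–Cantor on `[0,1]²` plus the extreme value theorem,
and `M/N → 0` (the two smallness facts are `rungPartition_eventually_div_lt`,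
`rungPartition_eventually_tan_lt` of the rung-4 partition file). [folklore] -/
theorem stub_saPartition :
    ∀ (A B : ℝ → ℝ) (M : ℝ), ContinuousOn A (Set.Icc (0:ℝ) 1) → ContinuousOn B (Set.Icc (0:ℝ) 1) →
      (∀ u ∈ Set.Icc (0:ℝ) 1, A u ^ 2 + B u ^ 2 ≠ 0) → 0 ≤ M →
      ∃ N : ℕ, 1 ≤ N ∧
        (∀ k : ℕ, k < N → ∀ u ∈ Set.Icc ((k : ℝ) / N) (((k : ℝ) + 1) / N),
          0 < A u * A ((k : ℝ) / N) + B u * B ((k : ℝ) / N)) ∧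
        M / N < Real.pi / 2 ∧ M * Real.tan (M / N) ^ 2 < Real.pi / 2 := by
  intro A B M hA hB hAB _hM
  obtain ⟨N, hN1, hN, hN2, hN3⟩ := ((Filter.eventually_ge_atTop 1).and
    ((saPartition_eventually_pos A B hA hB hAB).and
      ((rungPartition_eventually_div_lt M).and (rungPartition_eventually_tan_lt M)))).exists
  exact ⟨N, hN1, hN, hN2, hN3⟩

end Summit.KontsevichZagierPeriods.KontsevichZagierPeriods.Cruxes.StokesGeneration.FibrewiseStokes
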